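import Summits.CriticalPhenomena.PercolationContinuityZ3.Theorems.PercNearOneGluingNoHeavyLowerTailSahiGridPatternCoCountProductNCrossedAligned

/-!
# `NoHeavyLowerTail` (crux stmt-CriticalPhenomena-4575), Sahi programme P1: **THE MIXING INJECTION** — for a principal up-set `↑a'`, ANY up-set `B′`
# and any nonnegative weight `φ` of the third point:  `Σ_{q ≥ a', r ∈ B′, q δ̸ r} φ(q̄r) ≤ Σ_{m ∈ ↑a' ∩ B′} Σ_{s δ̸ m} φ(s)`

Support file (Sahi cell, seat `prim-sahi-p1`, generation 42; `--supports stmt-CriticalPhenomena-4575`).  Pure proofs, no definitions, no `sorry`, standard axioms.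
Vocabulary of `…SahiGridPattern{,SliceForm,Kleitman,CoCountProductNCrossedAligned}`.

THE MATHEMATICS (seat memo FROM-prim-sahi-p1-gen42 §8 (F2)).  Fix `a' ∈ [3]^k` and a coordinate set `Sx`.  For a totally distinct pair `(q,r)` with `q ≥ a'` put,
coordinate by coordinate, `lo_i = min(q_i,r_i)` and SWAP the two entries iff `(i ∈ Sx ↔ a'_i ≤ lo_i)`; let `m` be the point that takes the (possibly swapped)
first entry on `Sx` and the second entry off `Sx`.  Then `m_i ∈ {q_i, r_i}` (so `m δ̸ q̄r`), `m ≥ a'` AND `m ≥ r` (check the four cases), hence `m ∈ ↑a' ∩ B′` whenever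
`r ∈ B′` (up-set); and `(q,r) ↦ (m, q̄r)` is INJECTIVE (the unordered pair `{q_i,r_i}` is the complement of `(q̄r)_i`, and the rule tells which of the two is `m_i`).
Consequently (`pairThird_sum_le_mixCorner`)  `Σ_{q,r} 1_{↑a'}(q) 1_{B′}(r) [q δ̸ r] φ(q̄r) ≤ Σ_{m,s} 1_{↑a'}(m) 1_{B′}(m) [m δ̸ s] φ(s)`  for every `φ ≥ 0`.
With `φ = 1 − 1_V` and `↑a' ⊆ V` this reads  `κ′_V(↑a', B′) ≤ H_V(↑a' ∩ B′)`  (Kleitman difference ≤ Harris slack of the footprint) — the inequality that, together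
with the frozen corner (`…FrozenCorner`) and the crossed identity (`…CoCountProductNCrossed`), yields Conjecture A at every crossed pair whose sections sit inside the
two arms of `V = ↑a ∪ ↑b` (memo §8).  Nothing here asserts Conjecture A or `PatternPos d` for `d ≥ 4`. [this work]
-/

namespace Summit.CriticalPhenomena.PercolationContinuityZ3.Theorems.SahiGridPattern

open Finset SahiGrid3
open scoped BigOperators

variable {k : ℕ}

/-- **The mixing injection inequality** (see the file header). [this work] -/
theorem pairThird_sum_le_mixCorner {A0 Bp : Finset (Pd k)} {a' : Pd k} (Sx : Finset (Fin k))
    (hA0 : ∀ q, q ∈ A0 ↔ a' ≤ q) (hBp : IsUpperSet (Bp : Set (Pd k)))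
    (φ : Pd k → ℤ) (hφ : ∀ s, 0 ≤ φ s) :
    (∑ q : Pd k, ∑ r : Pd k, ind A0 q * ind Bp r * (if TotDist q r = true then (1:ℤ) else 0) * φ (thirdPt q r))
      ≤ ∑ m : Pd k, ∑ s : Pd k, ind A0 m * ind Bp m * (if TotDist m s = true then (1:ℤ) else 0) * φ s := by
  classical
  -- the map Φ : (q,r) ↦ (m, q̄r)
  let sw : Fin k → Fin 3 → Fin 3 → Prop := fun i x y => (i ∈ Sx ↔ a' i ≤ min x y)
  let mix : Pd k × Pd k → Pd k := fun p i =>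
    if i ∈ Sx then (if sw i (p.1 i) (p.2 i) then p.2 i else p.1 i) else (if sw i (p.1 i) (p.2 i) then p.1 i else p.2 i)
  let Φ : Pd k × Pd k → Pd k × Pd k := fun p => (mix p, thirdPt p.1 p.2)
  -- the two sums as sums over pairs with the filter of their support
  let Zs : Finset (Pd k × Pd k) := univ.filter (fun p => p.1 ∈ A0 ∧ p.2 ∈ Bp ∧ TotDist p.1 p.2 = true)
  let Hs : Finset (Pd k × Pd k) := univ.filter (fun p => p.1 ∈ A0 ∧ p.1 ∈ Bp ∧ TotDist p.1 p.2 = true)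
  have hL : (∑ q : Pd k, ∑ r : Pd k, ind A0 q * ind Bp r * (if TotDist q r = true then (1:ℤ) else 0) * φ (thirdPt q r))
      = ∑ p ∈ Zs, φ (thirdPt p.1 p.2) := by
    rw [← Fintype.sum_prod_type' (fun q r => ind A0 q * ind Bp r * (if TotDist q r = true then (1:ℤ) else 0) * φ (thirdPt q r))]
    rw [Finset.sum_filter]
    refine Finset.sum_congr rfl fun p _ => ?_
    unfold ind
    by_cases h1 : p.1 ∈ A0 <;> by_cases h2 : p.2 ∈ Bp <;> by_cases h3 : TotDist p.1 p.2 = true <;> simp [h1, h2, h3]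
  have hR : (∑ m : Pd k, ∑ s : Pd k, ind A0 m * ind Bp m * (if TotDist m s = true then (1:ℤ) else 0) * φ s)
      = ∑ p ∈ Hs, φ p.2 := by
    rw [← Fintype.sum_prod_type' (fun m s => ind A0 m * ind Bp m * (if TotDist m s = true then (1:ℤ) else 0) * φ s)]
    rw [Finset.sum_filter]
    refine Finset.sum_congr rfl fun p _ => ?_
    unfold ind
    by_cases h1 : p.1 ∈ A0 <;> by_cases h2 : p.1 ∈ Bp <;> by_cases h3 : TotDist p.1 p.2 = true <;> simp [h1, h2, h3]
  rw [hL, hR]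
  -- coordinatewise facts about `mix`
  have hmix_mem : ∀ p : Pd k × Pd k, ∀ i, mix p i = p.1 i ∨ mix p i = p.2 i := by
    intro p i
    simp only [mix]
    by_cases hi : i ∈ Sx <;> by_cases hs : sw i (p.1 i) (p.2 i) <;> simp [hi, hs]
  have hmix_ge_a : ∀ p : Pd k × Pd k, a' ≤ p.1 → (∀ i, p.1 i ≠ p.2 i) → a' ≤ mix p := by
    intro p hq htd i
    simp only [mix]
    by_cases hi : i ∈ Sx
    · by_cases hs : sw i (p.1 i) (p.2 i)
      · simp only [hi, hs, if_true]
        have : a' i ≤ min (p.1 i) (p.2 i) := (show (i ∈ Sx ↔ a' i ≤ min (p.1 i) (p.2 i)) from hs).1 hi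
        exact le_trans this (min_le_right _ _)
      · simp only [hi, hs, if_true, if_false]; exact hq i
    · by_cases hs : sw i (p.1 i) (p.2 i)
      · simp only [hi, hs, if_false, if_true]; exact hq i
      · simp only [hi, hs, if_false]
        -- not swapped off Sx means a' i ≤ min, so p.2 i ≥ a' i
        have : a' i ≤ min (p.1 i) (p.2 i) := by
          by_contra hc
          exact hs ((iff_of_false hi hc))
        exact le_trans this (min_le_right _ _)
  have hmix_ge_r : ∀ p : Pd k × Pd k, a' ≤ p.1 → (∀ i, p.1 i ≠ p.2 i) → p.2 ≤ mix p := by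
    intro p hq htd i
    simp only [mix]
    by_cases hi : i ∈ Sx
    · by_cases hs : sw i (p.1 i) (p.2 i)
      · simp only [hi, hs, if_true]; exact le_rfl
      · simp only [hi, hs, if_true, if_false]
        -- i ∈ Sx, not swapped: min < a' i ≤ p.1 i, so p.2 i = min ≤ p.1 i
        have hlt : ¬ a' i ≤ min (p.1 i) (p.2 i) := fun h => hs ((iff_of_true hi h))
        have h1 : ¬ a' i ≤ p.2 i ∨ p.2 i ≤ p.1 i := by
          rcases le_total (p.1 i) (p.2 i) with h | h
          · exact absurd (le_trans (hq i) (le_min le_rfl h)) hlt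
          · exact Or.inr h
        rcases h1 with h | h
        · rcases le_total (p.1 i) (p.2 i) with h' | h'
          · exact absurd (le_trans (hq i) (le_min le_rfl h')) hlt
          · exact h'
        · exact h
    · by_cases hs : sw i (p.1 i) (p.2 i)
      · simp only [hi, hs, if_false, if_true]
        -- i ∉ Sx, swapped: ¬ (a' i ≤ min), so min = p.2 i < a' i ≤ p.1 i
        have hlt : ¬ a' i ≤ min (p.1 i) (p.2 i) := fun h => hi ((show (i ∈ Sx ↔ _) from hs).2 h)
        rcases le_total (p.1 i) (p.2 i) with h' | h'
        · exact absurd (le_trans (hq i) (le_min le_rfl h')) hlt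
        · exact h'
      · simp only [hi, hs, if_false]; exact le_rfl
  have htd_mix : ∀ p : Pd k × Pd k, (∀ i, p.1 i ≠ p.2 i) → TotDist (mix p) (thirdPt p.1 p.2) = true := by
    intro p htd
    rw [totDist_iff]
    intro i
    simp only [thirdPt]
    rcases hmix_mem p i with h | h <;> rw [h]
    · -- p.1 i ≠ -(p.1 i + p.2 i)
      have := htd i
      revert this; generalize p.1 i = x; generalize p.2 i = y; revert x y; decide
    · have := htd i
      revert this; generalize p.1 i = x; generalize p.2 i = y; revert x y; decide
  -- image of Zs lies in Hs
  have hmaps : ∀ p ∈ Zs, Φ p ∈ Hs := by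
    intro p hp
    simp only [Zs, Finset.mem_filter, Finset.mem_univ, true_and] at hp
    obtain ⟨h1, h2, h3⟩ := hp
    have htd := totDist_iff.1 h3
    have hq : a' ≤ p.1 := (hA0 p.1).1 h1
    simp only [Hs, Φ, Finset.mem_filter, Finset.mem_univ, true_and]
    refine ⟨(hA0 _).2 (hmix_ge_a p hq htd), ?_, htd_mix p htd⟩
    exact hBp (hmix_ge_r p hq htd) (Finset.mem_coe.2 h2)
  -- injectivity of Φ on Zs
  have hinj : Set.InjOn Φ (Zs : Set (Pd k × Pd k)) := by
    intro p hp p' hp' hpp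
    simp only [Finset.coe_filter, Zs, Set.mem_setOf_eq, Finset.mem_univ, true_and] at hp hp'
    have htd := totDist_iff.1 hp.2.2
    have htd' := totDist_iff.1 hp'.2.2
    simp only [Φ, Prod.mk.injEq] at hpp
    obtain ⟨hm, hs⟩ := hpp
    -- coordinatewise: the unordered pairs agree (same third point), and the rule selects the same element
    have key : ∀ i, p.1 i = p'.1 i ∧ p.2 i = p'.2 i := by
      intro i
      have hmi := congrFun hm i
      have hsi := congrFun hs i
      simp only [thirdPt] at hsi
      simp only [mix] at hmi
      have h1 := htd i
      have h2 := htd' i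
      -- brute force over the finitely many values
      by_cases hi : i ∈ Sx
      · simp only [hi, if_true, sw, true_iff] at hmi
        revert hmi hsi h1 h2
        generalize p.1 i = x; generalize p.2 i = y; generalize p'.1 i = x'; generalize p'.2 i = y'; generalize a' i = z
        revert x y x' y' z; decide
      · simp only [hi, if_false, sw, false_iff] at hmi
        revert hmi hsi h1 h2
        generalize p.1 i = x; generalize p.2 i = y; generalize p'.1 i = x'; generalize p'.2 i = y'; generalize a' i = z
        revert x y x' y' z; decide
    exact Prod.ext (funext fun i => (key i).1) (funext fun i => (key i).2)
  -- conclude: Σ_{Zs} φ(third) = Σ_{Φ(Zs)} φ(snd) ≤ Σ_{Hs} φ(snd)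
  have himg : (∑ p ∈ Zs, φ (thirdPt p.1 p.2)) = ∑ p' ∈ Zs.image Φ, φ p'.2 := by
    rw [Finset.sum_image hinj]
  rw [himg]
  refine Finset.sum_le_sum_of_subset_of_nonneg ?_ (fun p _ _ => hφ p.2)
  intro p' hp'
  rw [Finset.mem_image] at hp'
  obtain ⟨p, hp, rfl⟩ := hp'
  exact hmaps p hp

end Summit.CriticalPhenomena.PercolationContinuityZ3.Theorems.SahiGridPattern
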